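import Literature.Computability.Cryptography.AffineHashStrings
import Literature.Computability.Complexity.ValiantVaziraniLemma
import Literature.Computability.Complexity.MajorityVote
import Literature.Computability.Cryptography.YaoAmplification
import HarnessLib

/-!
# Impagliazzo–Levin inversion, I: string-keyed hashing, isolation and majority-vote counting

Toolkit for the proof of Bogdanov–Trevisan's theorem "`(NP, U) ⊆ HeurBPP` ⇒ no one-way functions"
(ECCC TR06-073, §3.3, Thm. 22; FnT TCS 2(1), 2006, §4.3), carried out in
`ImpagliazzoLevinOWF.lean` along the route of their §5 (Impagliazzo–Levin's reduction, Thm. 29,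
with Claim 28 and the search-to-decision reduction of Thm. 21). The randomness of that reduction
consists of two affine hash functions over `𝔽₂` keyed by bit strings — the tree's family
`AffineStr.hashStr m k σ x` (`AffineHashStrings.lean`: row `j` of the key at bits
`j(m+1) … j(m+1)+m`, `hashStr_toList`, pairwise independence `isPairwiseIndep_hashV`) — and of
independent coin blocks for the repeated runs of a randomized heuristic scheme. This file supplies
the counting statements about them that the analysis consumes, all over uniformly distributed
**bit strings** (`List.Vector Bool ℓ`), proved from the matrix-level results of `AffineHashing.lean`
(`card_filter_hash_eq`, `card_filter_hash_pair`) and `ValiantVaziraniLemma.lean` (`valiant_vazirani`)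
through the equal-fibre transfer `Stockmeyer.card_filter_coinHash`:

* `card_hashStr_eq_zeros` — one-point uniformity: `#{σ ∈ {0,1}^ℓ : h_σ(r) = 0^b} · 2^b = 2^ℓ`;
* `card_hashStr_collide` — collision probability `2^{-a}`: `#{σ : h_σ(u) = h_σ(v)} · 2^a = 2^ℓ` for
  `u ≠ v` (Carter–Wegman);
* `vv_hashStr` — the Valiant–Vazirani isolation lemma keyed by strings: if
  `2^{b-2} ≤ |S| ≤ 2^{b-1}` then for at least `1/8` of the keys `σ ∈ {0,1}^ℓ` exactly one `r ∈ S`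
  has `h_σ(r) = 0^b`;
* counting over concatenated fields and blocks: `card_filter_forall_seg` (an event that is a
  conjunction over consecutive segments has the product count), `card_filter_blocks`
  (the consecutive `κ`-blocks of a uniform string of length `κT` are a uniform `T`-tuple),
  `card_filter_window` (a window of a uniform string is uniform);
* `maj` (strict majority of `true`s) and **`card_maj_fail_le`**: if a Boolean test passes on at
  least `3/4` of the coin strings of length `κ`, then the majority over `T ≥ 4/δ` independent
  blocks fails on at most a `δ` fraction of `{0,1}^{κT}` (Chebyshev form,
  `card_majority_fail_le` of `MajorityVote.lean`).

## References

* A. Bogdanov, L. Trevisan, *Average-Case Complexity*, ECCC TR06-073 (2006) = Found. Trends TCS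
  2(1) (2006): §3.2 (Thm. 21, Valiant–Vazirani isolation in the search-to-decision reduction),
  §5.1.3 (proof of Thm. 29: pairwise independence of `g`, union bound over `r`).
* R. Impagliazzo, L. Levin, *No better ways to generate hard NP instances than picking uniformly
  at random*, FOCS 1990, §4 (the family `g_{a,b}(r) = ar + b`, "the proofs below hold equally well
  for any such family").
* L. Valiant, V. Vazirani, *NP is as easy as detecting unique solutions*, TCS 47 (1986).
* J. L. Carter, M. N. Wegman, *Universal classes of hash functions*, JCSS 18 (1979).
* S. Arora, B. Barak, *Computational Complexity: A Modern Approach*, CUP 2009, Def. 8.14,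
  Lemma 17.19, §7.4.1 (error reduction by majority vote).
-/

namespace Literature.Computability.Cryptography

namespace ImpagliazzoLevin

open Finset Complexity Complexity.AffineHash Complexity.Stockmeyer AffineStr

/-! ### The string-keyed hash: zeros, one-point uniformity, collisions, isolation -/

/-- **`h_σ(r) = 0^b` iff the `𝔽₂`-hash read off `σ` vanishes at `r`** (`hash_coinHash_eq_zero_iff`).
[folklore] -/
theorem hashStr_eq_zeros_iff {n b : ℕ} (σ : List Bool) (r : List.Vector Bool n) :
    hashStr n b σ r.toList = List.replicate b false ↔ hash (coinHash σ n b) (toZ r) = 0 := by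
  rw [hash_coinHash_eq_zero_iff]
  unfold hashStr HashesToZero
  rw [List.take_of_length_le (le_of_eq (List.Vector.toList_length r)), List.eq_replicate_iff]
  simp only [List.length_map, List.length_range, true_and, List.forall_mem_map, List.mem_range]

/-- **One-point uniformity of the string-keyed affine hash**: for every key length
`ℓ ≥ b(n+1)` and every `r ∈ {0,1}^n`, `#{σ ∈ {0,1}^ℓ : h_σ(r) = 0^b} · 2^b = 2^ℓ`, i.e.
`Pr_σ[h_σ(r) = 0^b] = 2^{-b}` (equal fibres of the reading map and `card_filter_hash_eq`).
[Arora–Barak 2009, Def. 8.14; Bogdanov–Trevisan 2006, proof of Thm. 29 ("since the range of `g` is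
`{0,1}^{m-k-4}`, in expectation…")] [cite: AroraBarak2009, Def. 8.14] -/
theorem card_hashStr_eq_zeros {n b ℓ : ℕ} (hℓ : b * (n + 1) ≤ ℓ) (r : List.Vector Bool n) :
    (univ.filter fun σ : List.Vector Bool ℓ => hashStr n b σ.toList r.toList = List.replicate b false).card * 2 ^ b =
      2 ^ ℓ := by
  classical
  have h1 : (univ.filter fun σ : List.Vector Bool ℓ => hash (coinHash σ.toList n b) (toZ r) = 0).card *
      Fintype.card (Hash n b) = (univ.filter fun h : Hash n b => hash h (toZ r) = 0).card * 2 ^ ℓ := by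
    convert card_filter_coinHash hℓ (fun h : Hash n b => hash h (toZ r) = 0) using 4
  have h2 : (univ.filter fun h : Hash n b => hash h (toZ r) = 0).card * 2 ^ b = Fintype.card (Hash n b) := by
    convert card_filter_hash_eq (k := b) (toZ r) (0 : Fin b → ZMod 2) using 4
  have hpos : 0 < Fintype.card (Hash n b) := Fintype.card_pos
  have hcongr : (univ.filter fun σ : List.Vector Bool ℓ => hashStr n b σ.toList r.toList = List.replicate b false) =
      univ.filter fun σ : List.Vector Bool ℓ => hash (coinHash σ.toList n b) (toZ r) = 0 := by
    ext σ; simp only [mem_filter, mem_univ, true_and, hashStr_eq_zeros_iff]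
  rw [hcongr]
  refine Nat.eq_of_mul_eq_mul_right hpos ?_
  calc (univ.filter fun σ : List.Vector Bool ℓ => hash (coinHash σ.toList n b) (toZ r) = 0).card * 2 ^ b *
        Fintype.card (Hash n b)
      = (univ.filter fun σ : List.Vector Bool ℓ => hash (coinHash σ.toList n b) (toZ r) = 0).card *
          Fintype.card (Hash n b) * 2 ^ b := by ring
    _ = (univ.filter fun h : Hash n b => hash h (toZ r) = 0).card * 2 ^ ℓ * 2 ^ b := by rw [h1]
    _ = (univ.filter fun h : Hash n b => hash h (toZ r) = 0).card * 2 ^ b * 2 ^ ℓ := by ring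
    _ = 2 ^ ℓ * Fintype.card (Hash n b) := by rw [h2, Nat.mul_comm]

/-- **Collision probability of the string-keyed affine hash** (pairwise independence,
Carter–Wegman): for `ℓ ≥ a(m+1)` and distinct `u ≠ v ∈ {0,1}^m`,
`#{σ ∈ {0,1}^ℓ : h_σ(u) = h_σ(v)} · 2^a = 2^ℓ`, i.e. `Pr_σ[h_σ(u) = h_σ(v)] = 2^{-a}`
(`isPairwiseIndep_hashV` with `IsPairwiseIndep.card_collide`). [Carter–Wegman 1979; Arora–Barak
2009, Def. 8.14; Bogdanov–Trevisan 2006, proof of Thm. 29 (`Pr_h[h(S(n;r)) = h(x)] ≤ 2^{-k-7}`)]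
[cite: AroraBarak2009, Def. 8.14] -/
theorem card_hashStr_collide {m a ℓ : ℕ} (hℓ : a * (m + 1) ≤ ℓ) {u v : List.Vector Bool m} (huv : u ≠ v) :
    (univ.filter fun σ : List.Vector Bool ℓ =>
        hashStr m a σ.toList u.toList = hashStr m a σ.toList v.toList).card * 2 ^ a = 2 ^ ℓ := by
  classical
  have hK := isPairwiseIndep_hashV hℓ ({u, v} : Finset (List.Vector Bool m))
  have hc := hK.card_collide (by simp) (by simp) huv
  rw [Fintype.card_fun, ZMod.card, Fintype.card_fin, card_univ, card_vector, Fintype.card_bool] at hc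
  convert hc using 3
  ext σ
  simp only [hashStr_toList, (encZ_injective a).eq_iff]

/-- **The Valiant–Vazirani isolation lemma, keyed by strings.** If `S ⊆ {0,1}^n` satisfies
`2^b ≤ 4|S|` and `2|S| ≤ 2^b` (i.e. `2^{b-2} ≤ |S| ≤ 2^{b-1}`), then for at least a `1/8` fraction of
the keys `σ ∈ {0,1}^ℓ` (`ℓ ≥ b(n+1)`) exactly one `r ∈ S` has `h_σ(r) = 0^b`:
`2^ℓ ≤ 8 · #{σ : #{r ∈ S : h_σ(r) = 0^b} = 1}` (`AffineHash.valiant_vazirani` transferred along the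
reading map `σ ↦ (A_σ, b_σ)`, whose fibres are equal, `card_filter_coinHash`).
[Valiant–Vazirani 1986; Arora–Barak 2009, Lemma 17.19; Bogdanov–Trevisan 2006, §3.2 ("the argument
of Valiant and Vazirani guarantees … a unique `w` satisfying `h|_j(w) = 0` with constant
probability")] [cite: AroraBarak2009, Lemma 17.19] -/
theorem vv_hashStr {n b ℓ : ℕ} (hℓ : b * (n + 1) ≤ ℓ) (S : Finset (List.Vector Bool n))
    (hlo : 2 ^ b ≤ 4 * S.card) (hhi : 2 * S.card ≤ 2 ^ b) :
    2 ^ ℓ ≤ 8 * (univ.filter fun σ : List.Vector Bool ℓ =>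
      (S.filter fun r => hashStr n b σ.toList r.toList = List.replicate b false).card = 1).card := by
  classical
  set S' : Finset (Fin n → ZMod 2) := S.map ⟨toZ, toZ_injective⟩ with hS'def
  have hS' : S'.card = S.card := card_map _
  have hvv : Fintype.card (Hash n b) ≤
      8 * (univ.filter fun h : Hash n b => (S'.filter fun x => hash h x = 0).card = 1).card := by
    convert valiant_vazirani (k := b) S' (by rw [hS']; exact hlo) (by rw [hS']; exact hhi) using 5
  have hfib : (univ.filter fun σ : List.Vector Bool ℓ =>
        (S'.filter fun x => hash (coinHash σ.toList n b) x = 0).card = 1).card * Fintype.card (Hash n b) =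
      (univ.filter fun h : Hash n b => (S'.filter fun x => hash h x = 0).card = 1).card * 2 ^ ℓ := by
    convert card_filter_coinHash hℓ (fun h : Hash n b => (S'.filter fun x => hash h x = 0).card = 1) using 4
  have hrel : ∀ σ : List Bool, (S.filter fun r => hashStr n b σ r.toList = List.replicate b false).card =
      (S'.filter fun x => hash (coinHash σ n b) x = 0).card := by
    intro σ
    rw [hS'def, Finset.filter_map, card_map]
    congr 1
    ext r
    simp only [mem_filter, Function.Embedding.coeFn_mk, Function.comp_apply, hashStr_eq_zeros_iff]
  have hcongr : (univ.filter fun σ : List.Vector Bool ℓ =>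
        (S.filter fun r => hashStr n b σ.toList r.toList = List.replicate b false).card = 1) =
      univ.filter fun σ : List.Vector Bool ℓ =>
        (S'.filter fun x => hash (coinHash σ.toList n b) x = 0).card = 1 := by
    ext σ; simp only [mem_filter, mem_univ, true_and, hrel]
  rw [hcongr]
  have hpos : 0 < Fintype.card (Hash n b) := Fintype.card_pos
  refine Nat.le_of_mul_le_mul_right ?_ hpos
  calc 2 ^ ℓ * Fintype.card (Hash n b)
      ≤ 2 ^ ℓ * (8 * (univ.filter fun h : Hash n b => (S'.filter fun x => hash h x = 0).card = 1).card) :=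
        Nat.mul_le_mul_left _ hvv
    _ = 8 * ((univ.filter fun h : Hash n b => (S'.filter fun x => hash h x = 0).card = 1).card * 2 ^ ℓ) := by
        ring
    _ = 8 * ((univ.filter fun σ : List.Vector Bool ℓ =>
          (S'.filter fun x => hash (coinHash σ.toList n b) x = 0).card = 1).card * Fintype.card (Hash n b)) := by
        rw [hfib]
    _ = 8 * (univ.filter fun σ : List.Vector Bool ℓ =>
          (S'.filter fun x => hash (coinHash σ.toList n b) x = 0).card = 1).card * Fintype.card (Hash n b) := by
        ring

/-- **Good levels exist** (restated from `AffineHash.exists_goodLevel` for sets of `n`-bit strings):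
every nonempty `S ⊆ {0,1}^n` has a level `b ≤ n + 2` with `2^b ≤ 4|S|` and `2|S| ≤ 2^b`.
[Arora–Barak 2009, proof of Thm. 17.18; Bogdanov–Trevisan 2006, §3.2 ("if `j` is the logarithm of
the number of `L`-witnesses for `x`")] [cite: AroraBarak2009, Thm. 17.18 (proof)] -/
theorem exists_goodLevel_finset {n : ℕ} (S : Finset (List.Vector Bool n)) (hS : S.Nonempty) :
    ∃ b ≤ n + 2, 2 ^ b ≤ 4 * S.card ∧ 2 * S.card ≤ 2 ^ b := by
  refine exists_goodLevel (Finset.card_pos.2 hS) ?_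
  calc S.card ≤ (univ : Finset (List.Vector Bool n)).card := card_le_univ _
    _ = 2 ^ n := by rw [card_univ, card_vector, Fintype.card_bool]

/-! ### Counting over fields, segments and blocks of a uniform bit string -/

/-- A predicate of the first field only: `#{v ∈ {0,1}^{a+b} : P (v↾a)} = #P · 2^b`. [folklore] -/
theorem card_filter_take (a b : ℕ) (Pa : List Bool → Prop) [DecidablePred Pa] :
    (univ.filter fun v : List.Vector Bool (a + b) => Pa (v.toList.take a)).card =
      (univ.filter fun u : List.Vector Bool a => Pa u.toList).card * 2 ^ b := by
  have h := Yao.card_filter_take_drop a b Pa (fun _ => True)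
  rw [Finset.filter_true_of_mem (s := (univ : Finset (List.Vector Bool b))) (fun _ _ => trivial), card_univ,
    card_vector, Fintype.card_bool] at h
  simpa only [and_true] using h

/-- A predicate of the second field only: `#{v ∈ {0,1}^{a+b} : Q (v⇂a)} = 2^a · #Q`. [folklore] -/
theorem card_filter_drop (a b : ℕ) (Qb : List Bool → Prop) [DecidablePred Qb] :
    (univ.filter fun v : List.Vector Bool (a + b) => Qb (v.toList.drop a)).card =
      2 ^ a * (univ.filter fun w : List.Vector Bool b => Qb w.toList).card := by
  have h := Yao.card_filter_take_drop a b (fun _ => True) Qb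
  rw [Finset.filter_true_of_mem (s := (univ : Finset (List.Vector Bool a))) (fun _ _ => trivial), card_univ,
    card_vector, Fintype.card_bool] at h
  simpa only [true_and] using h

/-- **A window of a uniform string is uniform**: `#{v ∈ {0,1}^{pre + (R + post)} : E ((v⇂pre)↾R)} =
2^pre · #{s ∈ {0,1}^R : E s} · 2^post`. [folklore] -/
theorem card_filter_window (pre R post : ℕ) (E : List Bool → Prop) [DecidablePred E] :
    (univ.filter fun v : List.Vector Bool (pre + (R + post)) => E ((v.toList.drop pre).take R)).card =
      2 ^ pre * ((univ.filter fun s : List.Vector Bool R => E s.toList).card * 2 ^ post) := by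
  rw [card_filter_drop pre (R + post) (fun w => E (w.take R)), card_filter_take R post E]

/-- The `i`-th segment of length `L` of a string: `(w ⇂ iL) ↾ L`. [folklore] -/
def seg (L i : ℕ) (w : List Bool) : List Bool := (w.drop (i * L)).take L

/-- Segment `0` is the prefix. [folklore] -/
theorem seg_zero (L : ℕ) (w : List Bool) : seg L 0 w = w.take L := by simp [seg]

/-- Segment `i + 1` is segment `i` of the tail. [folklore] -/
theorem seg_succ (L i : ℕ) (w : List Bool) : seg L (i + 1) w = seg L i (w.drop L) := by
  simp only [seg, List.drop_drop]
  congr 2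
  ring

/-- A segment that fits has length `L`. [folklore] -/
theorem length_seg_of_le {L i : ℕ} {w : List Bool} (h : (i + 1) * L ≤ w.length) : (seg L i w).length = L := by
  simp only [seg, List.length_take, List.length_drop]
  rw [Nat.add_mul, one_mul] at h
  omega

/-- **Product rule over consecutive segments** (independent blocks of a uniform string): the
number of strings of length `L·n + e` whose `i`-th segment satisfies `M i` for every `i < n` is
`(∏_{i<n} #{s ∈ {0,1}^L : M i s}) · 2^e`. [folklore] -/
theorem card_filter_forall_seg (L : ℕ) (M : ℕ → List Bool → Prop) [∀ i, DecidablePred (M i)] :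
    ∀ (n e : ℕ), (univ.filter fun v : List.Vector Bool (L * n + e) => ∀ i < n, M i (seg L i v.toList)).card =
      (∏ i ∈ range n, (univ.filter fun s : List.Vector Bool L => M i s.toList).card) * 2 ^ e
  | 0, e => by simp [card_vector]
  | n + 1, e => by
    have hlen : L * (n + 1) + e = L + (L * n + e) := by ring
    rw [Yao.card_filter_vector_congr hlen (fun w => ∀ i < n + 1, M i (seg L i w))]
    have h := Yao.card_filter_take_drop L (L * n + e) (M 0) (fun w => ∀ i < n, M (i + 1) (seg L i w))
    rw [card_filter_forall_seg L (fun i => M (i + 1)) n e] at h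
    calc (univ.filter fun v : List.Vector Bool (L + (L * n + e)) => ∀ i < n + 1, M i (seg L i v.toList)).card
        = (univ.filter fun v : List.Vector Bool (L + (L * n + e)) =>
            M 0 (v.toList.take L) ∧ ∀ i < n, M (i + 1) (seg L i (v.toList.drop L))).card := by
          congr 1
          ext v
          simp only [Finset.mem_filter, Finset.mem_univ, true_and]
          constructor
          · intro hv
            refine ⟨by simpa [seg_zero] using hv 0 (Nat.succ_pos n), fun i hi => ?_⟩
            rw [← seg_succ]
            exact hv (i + 1) (by omega)
          · rintro ⟨h0, hs⟩ i hi
            rcases i with _ | i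
            · simpa [seg_zero] using h0
            · rw [seg_succ]; exact hs i (by omega)
      _ = _ := by rw [h, Finset.prod_range_succ', mul_comm ((univ.filter fun s : List.Vector Bool L => M 0 s.toList).card)]
                  ring

/-- The tuple of the first `T` blocks of length `κ` of a string of length `κ T`. [folklore] -/
def blocks (κ T : ℕ) (v : List.Vector Bool (κ * T)) : Fin T → List.Vector Bool κ :=
  fun t => ⟨seg κ t v.toList, length_seg_of_le (by
    rw [List.Vector.toList_length, Nat.mul_comm κ T]; exact Nat.mul_le_mul_right κ t.2)⟩

/-- **Consecutive blocks of a uniform string form a uniform tuple**: for every property `Φ` of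
`T`-tuples of `κ`-bit strings, `#{v ∈ {0,1}^{κT} : Φ (blocks v)} = #{ω : Fin T → {0,1}^κ | Φ ω}`
(`blocks` is a bijection). [folklore] -/
theorem card_filter_blocks (κ T : ℕ) (Φ : (Fin T → List.Vector Bool κ) → Prop) [DecidablePred Φ] :
    (univ.filter fun v : List.Vector Bool (κ * T) => Φ (blocks κ T v)).card =
      (univ.filter fun ω : Fin T → List.Vector Bool κ => Φ ω).card := by
  classical
  -- `blocks` is injective, and both sides have `2^{κT}` elements, so it is a bijection
  have hinj : Function.Injective (blocks κ T) := by
    intro v w hvw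
    apply List.Vector.ext
    intro j
    -- position `j = t κ + s` lies in block `t`
    have hj := j.2
    obtain ⟨t, s, hs, hjts⟩ : ∃ t s, s < κ ∧ (j : ℕ) = t * κ + s :=
      ⟨j / κ, j % κ, Nat.mod_lt _ (Nat.pos_of_ne_zero (by rintro rfl; simp at hj)), (Nat.div_add_mod' j κ).symm⟩
    have ht : t < T := by
      by_contra hle
      push Not at hle
      have : κ * T ≤ t * κ := by rw [Nat.mul_comm]; exact Nat.mul_le_mul_right κ hle
      omega
    have hb := congrFun hvw ⟨t, ht⟩
    have hb' := congrArg (fun u : List.Vector Bool κ => u.toList.getD s false) hb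
    simp only [blocks, seg, List.Vector.toList_mk, List.getD_eq_getElem?_getD, List.getElem?_take,
      if_pos hs, List.getElem?_drop] at hb'
    rw [List.Vector.get_eq_get_toList, List.Vector.get_eq_get_toList]
    simp only [List.get_eq_getElem]
    have hv : (j : ℕ) < v.toList.length := by simp
    have hw : (j : ℕ) < w.toList.length := by simp
    rw [← hjts] at hb'
    simpa [List.getElem?_eq_getElem hv, List.getElem?_eq_getElem hw] using hb'
  have hcard : Fintype.card (List.Vector Bool (κ * T)) = Fintype.card (Fin T → List.Vector Bool κ) := by
    rw [card_vector, Fintype.card_fun, card_vector, Fintype.card_bool, Fintype.card_fin, ← pow_mul]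
  have hbij : Function.Bijective (blocks κ T) := (Fintype.bijective_iff_injective_and_card _).2 ⟨hinj, hcard⟩
  refine Finset.card_bij (fun v _ => blocks κ T v) (fun v hv => ?_) (fun v _ w _ h => hinj h) (fun ω hω => ?_)
  · simpa using hv
  · obtain ⟨v, rfl⟩ := hbij.2 ω
    exact ⟨v, by simpa using hω, rfl⟩

/-! ### Majority vote over independent coin blocks -/

/-- Strict majority of `true`s: `maj l = [|l| < 2 · #true(l)]`. [Arora–Barak 2009, §7.4.1]
[cite: AroraBarak2009, §7.4.1] -/
def maj (l : List Bool) : Bool := decide (l.length < 2 * l.count true)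

/-- The number of `true`s among `[g 0, …, g (T-1)]` is the number of indices `t < T` with `g t`.
[folklore] -/
theorem count_map_range (T : ℕ) (g : ℕ → Bool) :
    ((List.range T).map g).count true = (univ.filter fun t : Fin T => g t = true).card := by
  rw [Finset.card_filter, Fin.sum_univ_eq_sum_range (fun t => if g t = true then 1 else 0) T]
  induction T with
  | zero => simp
  | succ T ih =>
    rw [List.range_succ, List.map_append, List.count_append, ih, Finset.sum_range_succ, List.map_singleton]
    cases g T <;> simp

/-- **Majority vote over independent blocks, counting form.** Let `g` be a Boolean test on
`κ`-bit strings passing on at least `3/4` of them (`3 · 2^κ ≤ 4 · #{ρ : g ρ}`), and let `T ≥ 4/δ`.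
Then the strict majority of `g` over the `T` consecutive `κ`-blocks of a string `v ∈ {0,1}^{κT}`
fails for at most `δ · 2^{κT}` strings `v` (Chebyshev: `card_majority_fail_le` with advantage
`η = 1/4`, transported along `card_filter_blocks`). This is the error reduction of a randomized
heuristic scheme on a good instance (inner constant `1/4`, Bogdanov–Trevisan Def. 2.12 and the
remark on its robustness). [Arora–Barak 2009, §7.4.1 (Thm. 7.10, error reduction); Bogdanov–Trevisan
2006, remark after Def. 2.11/2.12; Blum–Micali 1984, §3.3] [cite: AroraBarak2009, §7.4.1] -/
theorem card_maj_fail_le {κ T : ℕ} (g : List Bool → Bool) {δ : ℝ} (hδ : 0 < δ) (hT : 4 / δ ≤ T)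
    (hgood : 3 * 2 ^ κ ≤ 4 * (univ.filter fun ρ : List.Vector Bool κ => g ρ.toList = true).card) :
    ((univ.filter fun v : List.Vector Bool (κ * T) =>
        maj ((List.range T).map fun t => g (seg κ t v.toList)) = false).card : ℝ) ≤ δ * 2 ^ (κ * T) := by
  classical
  have h1 : (univ.filter fun v : List.Vector Bool (κ * T) =>
        maj ((List.range T).map fun t => g (seg κ t v.toList)) = false).card =
      (univ.filter fun ω : Fin T → List.Vector Bool κ =>
        2 * (univ.filter fun t : Fin T => g (ω t).toList = true).card ≤ T).card := by
    rw [← card_filter_blocks κ T (fun ω => 2 * (univ.filter fun t : Fin T => g (ω t).toList = true).card ≤ T)]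
    congr 1
    ext v
    simp only [mem_filter, mem_univ, true_and, maj, decide_eq_false_iff_not, not_lt, List.length_map,
      List.length_range, count_map_range T (fun t => g (seg κ t v.toList))]
    rfl
  rw [h1]
  haveI : Nonempty (List.Vector Bool κ) := ⟨⟨List.replicate κ false, List.length_replicate⟩⟩
  have hm : 1 / (4 * δ * (1 / 4 : ℝ) ^ 2) ≤ T := by
    have : (1 : ℝ) / (4 * δ * (1 / 4) ^ 2) = 4 / δ := by field_simp
    rw [this]; exact hT
  have hg : (1 / 2 + 1 / 4 : ℝ) * Fintype.card (List.Vector Bool κ) ≤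
      (univ.filter fun ρ : List.Vector Bool κ => g ρ.toList = true).card := by
    rw [card_vector, Fintype.card_bool]
    have h' : ((3 * 2 ^ κ : ℕ) : ℝ) ≤ ((4 * (univ.filter fun ρ : List.Vector Bool κ => g ρ.toList = true).card : ℕ) : ℝ) := by
      exact_mod_cast hgood
    push_cast at h' ⊢
    linarith
  have h2 := card_majority_fail_le (fun ρ : List.Vector Bool κ => g ρ.toList = true) (m := T)
    (by norm_num : (0 : ℝ) < 1 / 4) hδ hm hg
  rw [Fintype.card_fun, Fintype.card_fin, card_vector, Fintype.card_bool, ← pow_mul] at h2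
  push_cast at h2
  exact h2

end ImpagliazzoLevin

end Literature.Computability.Cryptography
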